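import Summits.MatrixMultiplication.OmegaCensus.SmallFormats.MatMul22nRankGF5XCapWlogWords
import Summits.MatrixMultiplication.OmegaCensus.SmallFormats.BoxCertificateOrbit
import HarnessLib

/-!
# ω-census family (a): the symmetric 350-row X-cap system over `𝔽₅` as a `BoxCert.System` and the orbital-certificate bridge

Cell `pub-omega` (unit `pub-omega-tensor-g11`), topic `Summits/MatrixMultiplication/OmegaCensus` (sub-folder `SmallFormats`).
Framing (verbatim): lottery ticket; floor = certified bounds/negative ranges. HONEST FRAMING: bookkeeping, no bound on a rank, not
progress on `ω`. `xcapSys5w0 s` = the 350 cap / row-plane rows of `xcapSys5s s` alone (columns filtered; no WLOG rows), i.e. exactly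
the symmetric system of `NoTightPoint5` (`MatMul22nRankGF5ThreeNPlusFiveReduction`). `apply5` = the word action of
`MatMul22nRankGF5XCapWlogWords` extended by the identity beyond index `157`; it preserves `Feasible`, the total and out-of-range
indices (`apply5_feasible`, `apply5_total`, `apply5_id`) — the three hypotheses of the orbital checker `BoxCert.CertO`
(`BoxCertificateOrbit`). Consequence `sum_lt_of_certO5`: a passing `CertO` certificate for `xcapSys5w0 s` bounds the total of every point
of `[0,s]^157` satisfying the 350 rows and a pattern hypothesis. Step (c)/(d) glue of the successor blueprint
`pub-omega-tensor-g11/METHOD-PARITY-g11.md` §3.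
-/

namespace Summit.MatrixMultiplication.OmegaCensus.SmallFormats

open Finset

/-- Columns of `xcapSys5` restricted to the 350 cap / row-plane rows. -/
def col5w0 (j : ℕ) : List (ℕ × ℤ) := (col5 j).filter fun e => e.1 < 350

/-- The symmetric (WLOG-free) X-cap system at slack `s`. -/
def xcapSys5w0 (s : ℕ) : BoxCert.System := ⟨157, 350, col5w0, rhs5s s⟩

/-- Column well-formedness (by construction of the filter). -/
theorem xcapSys5w0_colWF (s : ℕ) : (xcapSys5w0 s).ColWF := by
  intro j e he
  change e ∈ (col5 j).filter (fun e => e.1 < 350) at he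
  exact (List.mem_filter.1 he).2 |> of_decide_eq_true

/-- Below row `350` the coefficients agree with `xcapSys5s`. -/
theorem xcapSys5w0_A {s : ℕ} {r : ℕ} (hr : r < 350) (j : ℕ) : (xcapSys5w0 s).A r j = (xcapSys5s s).A r j := by
  change ((col5w0 j).filter (fun e => e.1 = r)).foldr (fun e acc => e.2 + acc) 0
    = ((col5 j).filter (fun e => e.1 = r)).foldr (fun e acc => e.2 + acc) 0
  unfold col5w0
  rw [List.filter_filter]
  congr 1
  apply List.filter_congr
  intro e _
  by_cases h : e.1 = r
  · simp [h, hr]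
  · simp [h]

/-- `Feasible` for the symmetric system is exactly "the 350 rows hold". -/
theorem feasible_w0_iff {s : ℕ} {x : ℕ → ℕ} : (xcapSys5w0 s).Feasible x ↔ ∀ r < 350, rowVal5 s x r ≤ rhs5s s r := by
  constructor
  · intro h r hr
    have h' := h r hr
    change ∑ j ∈ range 157, (xcapSys5w0 s).A r j * (x j : ℤ) ≤ rhs5s s r at h'
    unfold rowVal5
    rwa [sum_congr rfl fun j _ => by rw [xcapSys5w0_A hr]] at h'
  · intro h r hr
    change r < 350 at hr
    show ∑ j ∈ range 157, (xcapSys5w0 s).A r j * (x j : ℤ) ≤ rhs5s s r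
    rw [sum_congr rfl fun j _ => by rw [xcapSys5w0_A hr]]
    exact h r hr

/-- The word action, extended by the identity beyond the variable range. -/
def apply5 (w : List ℕ) (j : ℕ) : ℕ := if j < 157 then wordSig5 w j else j

/-- Orbit data for `CertO` over the `𝔽₅` system: the word action and a cell lookup (supplied per pattern case). -/
def orbitData5 (cellOf : ℕ → ℕ) : BoxCert.OrbitData := ⟨apply5, cellOf⟩

/-- `rowVal5` only reads the variables `< 157`. -/
theorem rowVal5_congr {s : ℕ} {x y : ℕ → ℕ} (h : ∀ j < 157, x j = y j) (r : ℕ) : rowVal5 s x r = rowVal5 s y r := by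
  unfold rowVal5
  exact sum_congr rfl fun j hj => by rw [h j (mem_range.1 hj)]

/-- Out of range the action is the identity. -/
theorem apply5_id (w : List ℕ) (j : ℕ) (hj : (xcapSys5w0 4).N ≤ j) : apply5 w j = j := by
  change 157 ≤ j at hj
  simp [apply5, show ¬ j < 157 by omega]

/-- The action preserves feasibility of the symmetric system. -/
theorem apply5_feasible {s : ℕ} (w : List ℕ) (x : ℕ → ℕ) (h : (xcapSys5w0 s).Feasible x) :
    (xcapSys5w0 s).Feasible fun j => x (apply5 w j) := by
  rw [feasible_w0_iff] at h ⊢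
  intro r hr
  rw [rowVal5_congr (y := fun j => x (wordSig5 w j)) (fun j hj => by simp [apply5, hj]) r]
  exact rows350_word w h r hr

/-- The action preserves the total (natural-number form, as used by `BoxCert`). -/
theorem apply5_total (w : List ℕ) (x : ℕ → ℕ) :
    ∑ j ∈ range (xcapSys5w0 4).N, x (apply5 w j) = ∑ j ∈ range (xcapSys5w0 4).N, x j := by
  change ∑ j ∈ range 157, x (apply5 w j) = ∑ j ∈ range 157, x j
  have h1 : ∑ j ∈ range 157, x (apply5 w j) = ∑ j ∈ range 157, x (wordSig5 w j) :=
    sum_congr rfl fun j hj => by simp [apply5, mem_range.1 hj]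
  have h2 := total_word w x
  rw [h1]
  exact_mod_cast h2

/-- **Orbital-certificate bridge.** A passing `CertO` certificate for the symmetric slack-`s` system (denominator `D`, target `T`,
box `[0,s]`, pattern table `Q` with cell lookup `cellOf`) bounds the total of every point satisfying the 350 rows and the pattern. -/
theorem sum_lt_of_certO5 {D T : ℕ} {Q : BoxCert.PatternData} {cellOf : ℕ → ℕ} (c : BoxCert.CertO)
    (hc : c.check (xcapSys5w0 4) Q (orbitData5 cellOf) D T 4 [] = true)
    (x : ℕ → ℕ) (hbox : ∀ j, x j ≤ 4) (h350 : ∀ r < 350, rowVal5 4 x r ≤ rhs5s 4 r) (hQ : Q.OK x) :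
    ∑ j ∈ range 157, x j < T := by
  have hf : (xcapSys5w0 4).Feasible x := feasible_w0_iff.2 h350
  exact BoxCert.CertO.sum_lt_of_check_root (S := xcapSys5w0 4) (Q := Q) (A := orbitData5 cellOf)
    (fun w x hx => apply5_feasible w x hx) (fun w x => apply5_total w x) (fun w j hj => apply5_id w j hj)
    (xcapSys5w0_colWF 4) c hc x hbox hf hQ

end Summit.MatrixMultiplication.OmegaCensus.SmallFormats
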